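import Summits.NavierStokesRegularity.NavierStokesRegularity.Theorems.PlaneEnergyCeilingPlanarEnergyAPrioriSmallDataBootstrap
import Summits.NavierStokesRegularity.NavierStokesRegularity.Theorems.PlaneEnergyCeilingPlanarEnergyAPrioriSmallDataInitialTime
import Summits.NavierStokesRegularity.NavierStokesRegularity.Theorems.PlaneEnergyCeilingBoundedPlanarEnergyRegularitySmallCorner
import Summits.NavierStokesRegularity.NavierStokesRegularity.Theorems.SlicedKelvinPlanarFluxAPrioriStubDecayPersistence
import Literature.Analysis.FluidPDE.TaoQuantitativeTotalSpeed
import HarnessLib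

/-!
# `PlanarEnergyAPriori` for small planar data, and Clay (A) for small planar data (unconditional)

Route `PlaneEnergyCeiling`, crux `PlanarEnergyAPriori` (stmt-NavierStokesRegularity-16855). This file
instantiates the abstract propagation theorem `planar_small_propagation`
(`SmallDataBootstrap.lean`) on classical Leray–Hopf solutions:

* `planarEnergyAPriori_smallData` — **the small-data corner of the crux**: there is an absolute
  `ε₀ > 0` such that a classical solution of unforced NS (`ν > 0`) on `ℝ³ × [0,T)`, Leray–Hopf from
  its rapidly decaying datum, whose datum has planar kinetic energies `≤ δ ν²` on every plane with
  `0 < δ ≤ ε₀`, keeps planar kinetic energies `≤ 4 δ ν²` on every plane for all `t < T`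
  (registered sub-goal of the crux item);
* `clayA_of_small_planar_data` — **the route's target `X = PlanarEnergyAPriori ∧
  BoundedPlanarEnergyRegularity` in the perturbative regime, end to end**: there is an absolute
  `ε > 0` such that every smooth divergence-free rapidly decaying datum `u₀` with planar energies
  `≤ ε ν²` on every plane has a global smooth solution with bounded energy (Clay (A)) — the a priori
  planar bound above feeds the continuation criterion `hasSmoothExtensionPast_of_planar_small`
  (crux 3's small corner) and the local Clay theory `stub_localClayTheory`.

Instantiation: normalise `ν = 1` (`w(s) = ν⁻¹ u(s/ν)`, planar energies scale by `ν⁻²`), clamp the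
time variable into a closed slab `[0, S']` (the clamped field is jointly continuous on `ℝ × ℝ³`,
globally bounded, with planar energies bounded via the cubic spatial decay of
`stub_decayPersistence`), obtain the Oseen representation from positive base times
(`mild_of_bounded_of_eLpNorm_two_le_of_lt`) and from the base time `0` (`oseenRepr_from_zero`), and
read off the propagated bound at `s = νt`.

## References

* T. Kato, Math. Z. 187 (1984). [Kato1984]
* G. Koch, N. Nadirashvili, G. Seregin, V. Šverák, Acta Math. 203 (2009), §4. [KochNadirashviliSereginSverak2009]
* T. Tao, Anal. PDE 6 (2013), Cor. 11.1 (arXiv:1108.1165). [Tao2011]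
-/

noncomputable section

-- single-conjunct summit: `Summit.<Summit>.<Problem>` repeats the name by the D-0017 layout
set_option linter.dupNamespace false

namespace Summit.NavierStokesRegularity.NavierStokesRegularity.Theorems.PlanarEnergyAPriori.SmallData

open MeasureTheory Set Function Filter Topology TopologicalSpace Metric WithLp
open scoped NNReal ENNReal
open Literature.Analysis Literature.Analysis.FluidPDE Literature.Analysis.FunctionSpaces

/-! ### Small tools -/

/-- A point of the plane `y ↦ R(y₀, y₁, c)` is at least as far from the origin as its parameter:
`‖y‖ ≤ ‖R(y₀,y₁,c)‖`. [folklore] -/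
theorem norm_le_norm_plane (R : EuclideanSpace ℝ (Fin 3) ≃ₗᵢ[ℝ] EuclideanSpace ℝ (Fin 3)) (c : ℝ)
    (y : EuclideanSpace ℝ (Fin 2)) : ‖y‖ ≤ ‖R (toLp 2 ![y 0, y 1, c])‖ := by
  rw [LinearIsometryEquiv.norm_map, EuclideanSpace.norm_eq, EuclideanSpace.norm_eq]
  refine Real.sqrt_le_sqrt ?_
  simp only [Fin.sum_univ_two, Fin.sum_univ_three, Real.norm_eq_abs, sq_abs]
  have h0 : (![y 0, y 1, c] : Fin 3 → ℝ) 0 = y 0 := rfl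
  have h1 : (![y 0, y 1, c] : Fin 3 → ℝ) 1 = y 1 := rfl
  have h2 : (![y 0, y 1, c] : Fin 3 → ℝ) 2 = c := rfl
  simp only [h0, h1, h2]
  nlinarith [sq_nonneg c]

/-- **Planar energies of a field with cubic spatial decay**: if `(1 + ‖x‖)³ ‖f x‖ ≤ C_d` then every
planar energy of `f` is at most `C_d² ∫_{ℝ²} (1 + ‖y‖)^{-6} dy`. [folklore] -/
theorem planar_le_of_cubic_decay {f : EuclideanSpace ℝ (Fin 3) → EuclideanSpace ℝ (Fin 3)} {Cd : ℝ}
    (hdec : ∀ x, (1 + ‖x‖) ^ 3 * ‖f x‖ ≤ Cd)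
    (R : EuclideanSpace ℝ (Fin 3) ≃ₗᵢ[ℝ] EuclideanSpace ℝ (Fin 3)) (c : ℝ) :
    ∫⁻ y : EuclideanSpace ℝ (Fin 2), ‖f (R (toLp 2 ![y 0, y 1, c]))‖ₑ ^ 2 ≤
      ENNReal.ofReal (Cd ^ 2 * ∫ y : EuclideanSpace ℝ (Fin 2), (1 + ‖y‖) ^ (-(6 : ℝ))) := by
  have hCd : 0 ≤ Cd := le_trans (by positivity) (hdec 0)
  have hint : Integrable (fun y : EuclideanSpace ℝ (Fin 2) => (1 + ‖y‖) ^ (-(6 : ℝ))) :=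
    integrable_one_add_norm (by rw [finrank_euclideanSpace_fin]; norm_num)
  -- pointwise: `‖f (Pl y)‖² ≤ Cd² (1 + ‖y‖)^{-6}`
  have hpt : ∀ y : EuclideanSpace ℝ (Fin 2), ‖f (R (toLp 2 ![y 0, y 1, c]))‖ₑ ^ 2 ≤
      ENNReal.ofReal (Cd ^ 2 * (1 + ‖y‖) ^ (-(6 : ℝ))) := by
    intro y
    set z : EuclideanSpace ℝ (Fin 3) := R (toLp 2 ![y 0, y 1, c]) with hz
    have hy1 : 0 < 1 + ‖y‖ := by linarith [norm_nonneg y]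
    have hyz : 1 + ‖y‖ ≤ 1 + ‖z‖ := by linarith [norm_le_norm_plane R c y]
    have h3 : (1 + ‖y‖) ^ 3 * ‖f z‖ ≤ Cd :=
      (mul_le_mul_of_nonneg_right (pow_le_pow_left₀ hy1.le hyz 3) (norm_nonneg _)).trans (hdec z)
    have hb : ‖f z‖ ≤ Cd * (1 + ‖y‖) ^ (-(3 : ℝ)) := by
      rw [Real.rpow_neg hy1.le, show ((3 : ℝ)) = ((3 : ℕ) : ℝ) by norm_num, Real.rpow_natCast,
        ← div_eq_mul_inv, le_div_iff₀ (by positivity), mul_comm]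
      exact h3
    rw [← ofReal_norm, ← ENNReal.ofReal_pow (norm_nonneg _)]
    refine ENNReal.ofReal_le_ofReal ?_
    have hb0 : 0 ≤ Cd * (1 + ‖y‖) ^ (-(3 : ℝ)) := by positivity
    calc ‖f z‖ ^ 2 ≤ (Cd * (1 + ‖y‖) ^ (-(3 : ℝ))) ^ 2 := pow_le_pow_left₀ (norm_nonneg _) hb 2
      _ = Cd ^ 2 * (1 + ‖y‖) ^ (-(6 : ℝ)) := by
          rw [mul_pow, ← Real.rpow_natCast ((1 + ‖y‖) ^ (-(3 : ℝ))) 2, ← Real.rpow_mul hy1.le]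
          norm_num
  calc ∫⁻ y : EuclideanSpace ℝ (Fin 2), ‖f (R (toLp 2 ![y 0, y 1, c]))‖ₑ ^ 2
      ≤ ∫⁻ y : EuclideanSpace ℝ (Fin 2), ENNReal.ofReal (Cd ^ 2 * (1 + ‖y‖) ^ (-(6 : ℝ))) := lintegral_mono hpt
    _ = ENNReal.ofReal (∫ y : EuclideanSpace ℝ (Fin 2), Cd ^ 2 * (1 + ‖y‖) ^ (-(6 : ℝ))) := by
        rw [← ofReal_integral_eq_lintegral_ofReal (hint.const_mul _)
          (Eventually.of_forall fun y => by positivity)]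
    _ = ENNReal.ofReal (Cd ^ 2 * ∫ y : EuclideanSpace ℝ (Fin 2), (1 + ‖y‖) ^ (-(6 : ℝ))) := by
        rw [integral_const_mul]

/-! ### The small-data corner of the crux -/

/-- **`PlanarEnergyAPriori` for small planar data (unconditional; registered sub-goal of
stmt-NavierStokesRegularity-16855).** There is an absolute `ε₀ > 0` such that: if `(u,p)` is a
classical solution of unforced NS (`ν > 0`) on `ℝ³ × [0,T)`, Leray–Hopf on `[0,T]` from its rapidly
decaying datum `u 0`, and the datum has planar kinetic energies `∫_{R({x₂=c})} ‖u 0‖² ≤ δ ν²` on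
every plane with `0 < δ ≤ ε₀`, then `∫_{R({x₂=c})} ‖u(t)‖² ≤ 4 δ ν²` on every plane for all
`t ∈ [0,T)` — the planar kinetic energy ceiling holds, quantitatively, for small planar data.
[cite: Kato1984, §1; KNSS 2009 §4; Tao 2013 Cor. 11.1] -/
theorem planarEnergyAPriori_smallData :
    ∃ ε₀ : ℝ, 0 < ε₀ ∧ ∀ (ν T : ℝ), 0 < ν → 0 < T →
      ∀ (u : ℝ → EuclideanSpace ℝ (Fin 3) → EuclideanSpace ℝ (Fin 3))
        (p : ℝ → EuclideanSpace ℝ (Fin 3) → ℝ),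
        Literature.Analysis.FluidPDE.IsClassicalNSSolutionOn (Set.Ico 0 T) ν 0 u p →
        Literature.Analysis.FluidPDE.IsLerayHopfOn T ν 0 (u 0) u →
        Literature.Analysis.FluidPDE.HasRapidSpatialDecay (u 0) →
        ∀ (δ : ℝ), 0 < δ → δ ≤ ε₀ →
        (∀ (R : EuclideanSpace ℝ (Fin 3) ≃ₗᵢ[ℝ] EuclideanSpace ℝ (Fin 3)) (c : ℝ),
          ∫⁻ y : EuclideanSpace ℝ (Fin 2), ‖u 0 (R (WithLp.toLp 2 ![y 0, y 1, c]))‖ₑ ^ 2 ≤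
            ENNReal.ofReal (δ * ν ^ 2)) →
        ∀ t ∈ Set.Ico 0 T, ∀ (R : EuclideanSpace ℝ (Fin 3) ≃ₗᵢ[ℝ] EuclideanSpace ℝ (Fin 3)) (c : ℝ),
          ∫⁻ y : EuclideanSpace ℝ (Fin 2), ‖u t (R (WithLp.toLp 2 ![y 0, y 1, c]))‖ₑ ^ 2 ≤
            ENNReal.ofReal (4 * δ * ν ^ 2) := by
  obtain ⟨εstar, ηstar, hεstar, -, hprop⟩ := planar_small_propagation
  refine ⟨εstar ^ 2, by positivity, ?_⟩
  intro ν T hν hT u p hcl hLH hdec δ hδ hδε hdata t ht R c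
  -- the initial time
  rcases ht.1.eq_or_lt with h0 | ht0
  · rw [← h0]
    refine (hdata R c).trans (ENNReal.ofReal_le_ofReal ?_)
    nlinarith [sq_nonneg ν]
  -- ### Step 1: normalise the viscosity; the slabs `s₁ = νt < S' < S'' < S = νT`
  have hν' : 0 < ν⁻¹ := inv_pos.2 hν
  have hνT : 0 < ν * T := mul_pos hν hT
  set s₁ : ℝ := ν * t with hs₁
  set S' : ℝ := ν * ((t + T) / 2) with hS'
  set S'' : ℝ := ν * ((t + 3 * T) / 4) with hS''
  have hs₁pos : 0 < s₁ := mul_pos hν ht0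
  have hs₁S' : s₁ < S' := by rw [hs₁, hS']; exact mul_lt_mul_of_pos_left (by linarith [ht.2]) hν
  have hS'S'' : S' < S'' := by rw [hS', hS'']; exact mul_lt_mul_of_pos_left (by linarith [ht.2]) hν
  have hS''S : S'' < ν * T := by rw [hS'']; exact mul_lt_mul_of_pos_left (by linarith [ht.2]) hν
  have hS'pos : 0 < S' := hs₁pos.trans hs₁S'
  have hS''pos : 0 < S'' := hS'pos.trans hS'S''
  have hS''T : ν⁻¹ * S'' ∈ Ico 0 T := by
    refine ⟨by positivity, ?_⟩
    rw [hS'', ← mul_assoc, inv_mul_cancel₀ hν.ne', one_mul]; linarith [ht.2]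
  set w : ℝ → EuclideanSpace ℝ (Fin 3) → EuclideanSpace ℝ (Fin 3) := timeRescale ν⁻¹ ν⁻¹ u with hwdef
  set q : ℝ → EuclideanSpace ℝ (Fin 3) → ℝ := timeRescale ν⁻¹ (ν⁻¹ ^ 2) p with hqdef
  have hmaps : MapsTo (fun s => ν⁻¹ * s) (Ioo 0 (ν * T)) (Ioo 0 T) := fun s hs =>
    (inv_mul_mem_Ioo_iff hν).2 hs
  have hclw : IsClassicalNSSolutionOn (Ioo 0 (ν * T)) 1 0 w q := by
    have h1 := (hcl.mono Ioo_subset_Ico_self (uniqueDiffOn_Ioo 0 T)).viscosityRescale_set hν.ne'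
      hmaps (uniqueDiffOn_Ioo 0 (ν * T))
    simpa only [timeRescale_zero_force] using h1
  have hw_apply : ∀ s x, w s x = ν⁻¹ • u (ν⁻¹ * s) x := fun s x => rfl
  -- ### Step 2: cubic decay on `[0, S'']`, transferred to `w`
  obtain ⟨C₀, hC₀⟩ := SlicedKelvinPlanarFluxAPriori.stub_decayPersistence ν T hν hT u p hcl hLH hdec
    (ν⁻¹ * S'') hS''T
  set Cd : ℝ := ν⁻¹ * C₀ with hCd
  have hdecw : ∀ σ ∈ Icc 0 S'', ∀ x, (1 + ‖x‖) ^ 3 * ‖w σ x‖ ≤ Cd := by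
    intro σ hσ x
    have hσ' : ν⁻¹ * σ ∈ Icc 0 (ν⁻¹ * S'') :=
      ⟨mul_nonneg hν'.le hσ.1, mul_le_mul_of_nonneg_left hσ.2 hν'.le⟩
    have h := hC₀ (ν⁻¹ * σ) hσ' x 0 (by norm_num)
    rw [norm_iteratedFDeriv_zero] at h
    rw [hw_apply, norm_smul, Real.norm_eq_abs, abs_of_pos hν', hCd]
    calc (1 + ‖x‖) ^ 3 * (ν⁻¹ * ‖u (ν⁻¹ * σ) x‖) = ν⁻¹ * ((1 + ‖x‖) ^ 3 * ‖u (ν⁻¹ * σ) x‖) := by ring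
      _ ≤ ν⁻¹ * C₀ := mul_le_mul_of_nonneg_left h hν'.le
  -- ### Step 3: the clamped field
  set cl : ℝ → ℝ := fun σ => max 0 (min σ S') with hcl_def
  have hcl_mem : ∀ σ, cl σ ∈ Icc 0 S' := fun σ =>
    ⟨le_max_left _ _, max_le hS'pos.le (min_le_right _ _)⟩
  have hcl_id : ∀ σ ∈ Icc 0 S', cl σ = σ := fun σ hσ => by
    simp only [hcl_def, min_eq_left hσ.2, max_eq_right hσ.1]
  have hcl_cont : Continuous cl := continuous_const.max (continuous_id.min continuous_const)
  set v : ℝ → EuclideanSpace ℝ (Fin 3) → EuclideanSpace ℝ (Fin 3) := fun σ x => w (cl σ) x with hvdef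
  have hv_eq : ∀ σ ∈ Icc 0 S', v σ = w σ := fun σ hσ => by
    funext x; simp only [hvdef, hcl_id σ hσ]
  -- joint continuity
  have hcontu : ContinuousOn (uncurry u) (Ico 0 T ×ˢ univ) := hcl.smooth_velocity.continuousOn
  have hvc : Continuous (uncurry v) := by
    have hg : Continuous fun q : ℝ × EuclideanSpace ℝ (Fin 3) => ((ν⁻¹ * cl q.1, q.2) : ℝ × EuclideanSpace ℝ (Fin 3)) :=
      (continuous_const.mul (hcl_cont.comp continuous_fst)).prodMk continuous_snd
    have hmem : ∀ q : ℝ × EuclideanSpace ℝ (Fin 3), ((ν⁻¹ * cl q.1, q.2) : ℝ × EuclideanSpace ℝ (Fin 3)) ∈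
        Ico 0 T ×ˢ (univ : Set (EuclideanSpace ℝ (Fin 3))) := by
      intro q
      refine ⟨⟨mul_nonneg hν'.le (hcl_mem q.1).1, ?_⟩, mem_univ _⟩
      calc ν⁻¹ * cl q.1 ≤ ν⁻¹ * S' := mul_le_mul_of_nonneg_left (hcl_mem q.1).2 hν'.le
        _ < T := by rw [hS', ← mul_assoc, inv_mul_cancel₀ hν.ne', one_mul]; linarith [ht.2]
    have h := (hcontu.comp_continuous hg hmem).const_smul ν⁻¹
    refine h.congr fun q => ?_
    simp only [Pi.smul_apply, Function.comp_apply, uncurry, hvdef, hw_apply]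
  have hvs : ∀ σ, Continuous (v σ) := fun σ => hvc.comp (continuous_const.prodMk continuous_id)
  have hvm : Measurable (uncurry v) := hvc.measurable
  -- global decay, sup and planar bounds of `v`
  have hdecv : ∀ σ x, (1 + ‖x‖) ^ 3 * ‖v σ x‖ ≤ Cd := fun σ x =>
    hdecw (cl σ) ⟨(hcl_mem σ).1, (hcl_mem σ).2.trans hS'S''.le⟩ x
  have hDv : ∀ σ x, ‖v σ x‖ ≤ Cd := by
    intro σ x
    have h1 : (1 : ℝ) ≤ (1 + ‖x‖) ^ 3 := one_le_pow₀ (by linarith [norm_nonneg x])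
    calc ‖v σ x‖ = 1 * ‖v σ x‖ := (one_mul _).symm
      _ ≤ (1 + ‖x‖) ^ 3 * ‖v σ x‖ := mul_le_mul_of_nonneg_right h1 (norm_nonneg _)
      _ ≤ Cd := hdecv σ x
  set P₆ : ℝ := ∫ y : EuclideanSpace ℝ (Fin 2), (1 + ‖y‖) ^ (-(6 : ℝ)) with hP₆
  have hP₆0 : 0 ≤ P₆ := integral_nonneg fun y => by positivity
  set Xap : ℝ := Real.sqrt (Cd ^ 2 * P₆) with hXap
  have hXap0 : 0 ≤ Xap := Real.sqrt_nonneg _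
  have hXapv : ∀ σ (R' : EuclideanSpace ℝ (Fin 3) ≃ₗᵢ[ℝ] EuclideanSpace ℝ (Fin 3)) (c' : ℝ),
      ∫⁻ y : EuclideanSpace ℝ (Fin 2), ‖v σ (R' (toLp 2 ![y 0, y 1, c']))‖ₑ ^ 2 ≤ ENNReal.ofReal (Xap ^ 2) := by
    intro σ R' c'
    rw [hXap, Real.sq_sqrt (by positivity)]
    exact planar_le_of_cubic_decay (hdecv σ) R' c'
  -- ### Step 4: the Oseen representation of `v` from every base time in `[0, S']`
  have hu₀2 : MemLp (u 0) 2 volume := hLH.memLp 0 ⟨le_rfl, hT.le⟩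
  have hmem_u : ∀ s ∈ Ioo 0 (ν * T), ν⁻¹ * s ∈ Icc 0 T := fun s hs =>
    ⟨(hmaps hs).1.le, (hmaps hs).2.le⟩
  set K₀ : ℝ≥0∞ := ENNReal.ofReal ν⁻¹ * eLpNorm (u 0) 2 volume with hK₀
  have hK₀top : K₀ ≠ ⊤ := ENNReal.mul_ne_top ENNReal.ofReal_ne_top hu₀2.eLpNorm_ne_top
  have hK₀b : ∀ s ∈ Ioo 0 (ν * T), eLpNorm (w s) 2 volume ≤ K₀ := by
    intro s hs
    have h1 : w s = ν⁻¹ • u (ν⁻¹ * s) := rfl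
    rw [h1, eLpNorm_const_smul, Real.enorm_eq_ofReal hν'.le, hK₀]
    gcongr
    exact hLH.eLpNorm_le_eLpNorm_datum hν.le hu₀2 (hmem_u s hs)
  have hbdw : ∀ τ ∈ Ioc 0 S'', ∀ x, ‖w τ x‖ ≤ Cd := by
    intro τ hτ x
    have h1 : (1 : ℝ) ≤ (1 + ‖x‖) ^ 3 := one_le_pow₀ (by linarith [norm_nonneg x])
    calc ‖w τ x‖ = 1 * ‖w τ x‖ := (one_mul _).symm
      _ ≤ (1 + ‖x‖) ^ 3 * ‖w τ x‖ := mul_le_mul_of_nonneg_right h1 (norm_nonneg _)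
      _ ≤ Cd := hdecw τ ⟨hτ.1.le, hτ.2⟩ x
  have hrep_pos : ∀ t₀ t', 0 < t₀ → t₀ < t' → t' ≤ S' → ∀ x,
      v t' x = UnboundedOperators.heatExtension (v t₀) (t' - t₀) x - oseenDuhamel 1 t₀ v v t' x := by
    intro t₀ t' ht₀ ht₀t' ht'S x
    have hw := mild_of_bounded_of_eLpNorm_two_le_of_lt hclw hS''pos hS''S hbdw hK₀top
      (fun τ hτ => hK₀b τ ⟨hτ.1, hτ.2.trans_lt hS''S⟩) ht₀ ht₀t' (ht'S.trans_lt hS'S'') x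
    have ht₀mem : t₀ ∈ Icc 0 S' := ⟨ht₀.le, ht₀t'.le.trans ht'S⟩
    have ht'mem : t' ∈ Icc 0 S' := ⟨ht₀.le.trans ht₀t'.le, ht'S⟩
    rw [hv_eq t' ht'mem, hv_eq t₀ ht₀mem, hw]
    congr 1
    exact (oseenDuhamel_congr_Ioo (fun τ hτ => hv_eq τ ⟨ht₀.le.trans hτ.1.le, hτ.2.le.trans ht'S⟩)
      (fun τ hτ => hv_eq τ ⟨ht₀.le.trans hτ.1.le, hτ.2.le.trans ht'S⟩) x).symm
  have hrep : ∀ t₀ t', 0 ≤ t₀ → t₀ < t' → t' ≤ S' → ∀ x,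
      v t' x = UnboundedOperators.heatExtension (v t₀) (t' - t₀) x - oseenDuhamel 1 t₀ v v t' x := by
    intro t₀ t' ht₀ ht₀t' ht'S x
    rcases ht₀.eq_or_lt with h0 | hpos
    · rw [← h0] at ht₀t' ⊢
      exact oseenRepr_from_zero hvc hdecv hrep_pos ht₀t' ht'S x
    · exact hrep_pos t₀ t' hpos ht₀t' ht'S x
  -- ### Step 5: the initial planar bound of `v`, `≤ (√δ)²`, and the propagation theorem
  have hplanar_w0 : ∀ (R' : EuclideanSpace ℝ (Fin 3) ≃ₗᵢ[ℝ] EuclideanSpace ℝ (Fin 3)) (c' : ℝ),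
      ∫⁻ y : EuclideanSpace ℝ (Fin 2), ‖v 0 (R' (toLp 2 ![y 0, y 1, c']))‖ₑ ^ 2 ≤
        ENNReal.ofReal (Real.sqrt δ ^ 2) := by
    intro R' c'
    rw [hv_eq 0 ⟨le_rfl, hS'pos.le⟩, Real.sq_sqrt hδ.le]
    have h1 : ∀ y : EuclideanSpace ℝ (Fin 2), ‖w 0 (R' (toLp 2 ![y 0, y 1, c']))‖ₑ ^ 2 =
        ENNReal.ofReal (ν⁻¹ ^ 2) * ‖u 0 (R' (toLp 2 ![y 0, y 1, c']))‖ₑ ^ 2 := by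
      intro y
      rw [hw_apply, mul_zero, enorm_smul, mul_pow, Real.enorm_eq_ofReal hν'.le, ENNReal.ofReal_pow hν'.le]
    simp_rw [h1]
    rw [lintegral_const_mul' _ _ ENNReal.ofReal_ne_top]
    calc ENNReal.ofReal (ν⁻¹ ^ 2) * ∫⁻ y : EuclideanSpace ℝ (Fin 2), ‖u 0 (R' (toLp 2 ![y 0, y 1, c']))‖ₑ ^ 2
        ≤ ENNReal.ofReal (ν⁻¹ ^ 2) * ENNReal.ofReal (δ * ν ^ 2) := by gcongr; exact hdata R' c'
      _ = ENNReal.ofReal δ := by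
          rw [← ENNReal.ofReal_mul (by positivity)]
          congr 1
          field_simp
  have hεle : Real.sqrt δ ≤ εstar := by
    rw [← Real.sqrt_sq hεstar.le]
    exact Real.sqrt_le_sqrt hδε
  have hmain := hprop hvm hvs hvc hDv hXap0 hXapv hS'pos hrep (Real.sqrt_pos.2 hδ) hεle hplanar_w0
    s₁ ⟨hs₁pos, hs₁S'.le⟩
  obtain ⟨hXs₁, -⟩ := hmain
  -- ### Step 6: back to `u` at time `t`
  have hws₁ : v s₁ = w s₁ := hv_eq s₁ ⟨hs₁pos.le, hs₁S'.le⟩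
  have hkey := hXs₁ R c
  rw [hws₁] at hkey
  have h1 : ∀ y : EuclideanSpace ℝ (Fin 2), ‖w s₁ (R (toLp 2 ![y 0, y 1, c]))‖ₑ ^ 2 =
      ENNReal.ofReal (ν⁻¹ ^ 2) * ‖u t (R (toLp 2 ![y 0, y 1, c]))‖ₑ ^ 2 := by
    intro y
    rw [hw_apply, hs₁, ← mul_assoc, inv_mul_cancel₀ hν.ne', one_mul, enorm_smul, mul_pow,
      Real.enorm_eq_ofReal hν'.le, ENNReal.ofReal_pow hν'.le]
  simp_rw [h1] at hkey
  rw [lintegral_const_mul' _ _ ENNReal.ofReal_ne_top, mul_pow, Real.sq_sqrt hδ.le] at hkey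
  -- `ν⁻² · X ≤ 4δ` ⇒ `X ≤ 4δν²`
  have hν2 : ENNReal.ofReal (ν ^ 2) * ENNReal.ofReal (ν⁻¹ ^ 2) = 1 := by
    rw [← ENNReal.ofReal_mul (by positivity), ← ENNReal.ofReal_one]
    congr 1
    field_simp
  calc ∫⁻ y : EuclideanSpace ℝ (Fin 2), ‖u t (R (toLp 2 ![y 0, y 1, c]))‖ₑ ^ 2
      = ENNReal.ofReal (ν ^ 2) * (ENNReal.ofReal (ν⁻¹ ^ 2) *
          ∫⁻ y : EuclideanSpace ℝ (Fin 2), ‖u t (R (toLp 2 ![y 0, y 1, c]))‖ₑ ^ 2) := by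
        rw [← mul_assoc, hν2, one_mul]
    _ ≤ ENNReal.ofReal (ν ^ 2) * ENNReal.ofReal (2 ^ 2 * δ) := mul_le_mul_right hkey _
    _ = ENNReal.ofReal (4 * δ * ν ^ 2) := by
        rw [← ENNReal.ofReal_mul (by positivity)]
        congr 1
        ring

/-! ### The route's target for small planar data -/

/-- **Clay (A) for data with small planar kinetic energies (unconditional).** There is an absolute
`ε > 0` such that for every `ν > 0` and every smooth, divergence-free, rapidly decaying datum `u₀` on
`ℝ³` whose planar kinetic energies satisfy `∫_{R({x₂=c})} ‖u₀‖² ≤ ε ν²` on every plane, there are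
`u`, `p` smooth on `ℝ³ × [0, ∞)` solving Navier–Stokes with datum `u₀` and bounded energy. This is
the route's target `X = PlanarEnergyAPriori ∧ BoundedPlanarEnergyRegularity` in the perturbative
regime, certified end to end: the a priori bound `planarEnergyAPriori_smallData` feeds the
continuation criterion `hasSmoothExtensionPast_of_planar_small` and the local Clay theory
`stub_localClayTheory`. [cite: Kato1984, §1; KNSS 2009 §4; Tao 2013 Cor. 11.1] -/
theorem clayA_of_small_planar_data :
    ∃ ε : ℝ, 0 < ε ∧ ∀ (ν : ℝ), 0 < ν →
      ∀ (u₀ : EuclideanSpace ℝ (Fin 3) → EuclideanSpace ℝ (Fin 3)),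
        ContDiff ℝ (⊤ : ℕ∞) u₀ → Literature.Analysis.FluidPDE.NSWave0.IsDivFree u₀ →
        Literature.Analysis.FluidPDE.HasRapidSpatialDecay u₀ →
        (∀ (R : EuclideanSpace ℝ (Fin 3) ≃ₗᵢ[ℝ] EuclideanSpace ℝ (Fin 3)) (c : ℝ),
          ∫⁻ y : EuclideanSpace ℝ (Fin 2), ‖u₀ (R (WithLp.toLp 2 ![y 0, y 1, c]))‖ₑ ^ 2 ≤
            ENNReal.ofReal (ε * ν ^ 2)) →
        ∃ (u : ℝ → EuclideanSpace ℝ (Fin 3) → EuclideanSpace ℝ (Fin 3))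
          (p : ℝ → EuclideanSpace ℝ (Fin 3) → ℝ),
          Literature.Analysis.FluidPDE.IsSmoothOnHalfSpace u ∧
          Literature.Analysis.FluidPDE.IsSmoothOnHalfSpace p ∧
          Literature.Analysis.FluidPDE.IsNavierStokesSolution ν 0 u₀ u p ∧
          Literature.Analysis.FluidPDE.HasBoundedEnergy u := by
  obtain ⟨ε₁, hε₁, hext⟩ := PlaneEnergyCeilingBoundedPlanarEnergyRegularity.hasSmoothExtensionPast_of_planar_small
  obtain ⟨ε₀, hε₀, hapr⟩ := planarEnergyAPriori_smallData
  refine ⟨min ε₀ (ε₁ / 4), lt_min hε₀ (by positivity), ?_⟩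
  intro ν hν u₀ hsm hdiv hdec hdata
  refine PlaneEnergyCeilingBoundedPlanarEnergyRegularity.stub_localClayTheory ν hν u₀ hsm hdiv hdec
    fun T hT u p hcl hLH h0 => ?_
  have hdec' : HasRapidSpatialDecay (u 0) := by rw [h0]; exact hdec
  have hdata' : ∀ (R : EuclideanSpace ℝ (Fin 3) ≃ₗᵢ[ℝ] EuclideanSpace ℝ (Fin 3)) (c : ℝ),
      ∫⁻ y : EuclideanSpace ℝ (Fin 2), ‖u 0 (R (WithLp.toLp 2 ![y 0, y 1, c]))‖ₑ ^ 2 ≤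
        ENNReal.ofReal (min ε₀ (ε₁ / 4) * ν ^ 2) := by
    intro R c; rw [h0]; exact hdata R c
  have hpl := hapr ν T hν hT u p hcl hLH hdec' (min ε₀ (ε₁ / 4)) (lt_min hε₀ (by positivity))
    (min_le_left _ _) hdata'
  refine hext ν T hν hT u p hcl hLH hdec' fun t ht R c => (hpl t ht R c).trans (ENNReal.ofReal_le_ofReal ?_)
  have : min ε₀ (ε₁ / 4) ≤ ε₁ / 4 := min_le_right _ _
  nlinarith [sq_nonneg ν]

end Summit.NavierStokesRegularity.NavierStokesRegularity.Theorems.PlanarEnergyAPriori.SmallData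

end
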